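import Summits.HodgeConjecture.HodgeConjecture.Theorems.F0P3bLocalNonsplitCompactCenter   -- ★ p825600 (A-p19 (g17)): `local_nonsplit_compactOpen_center_of_center_le`
import Literature.NumberTheory.Automorphic.LocalUnitaryGroupCenter                       -- ★ `UnitaryGroup.forall_mem_center_cmLocal_eq_scalar` (central ⇒ scalar)
import Literature.NumberTheory.Automorphic.LocalUnitaryGroupCongr                        -- ★ `antidiagOne_isHermitian`, `isUnit_antidiagOne_det`
import Literature.NumberTheory.Automorphic.UnitaryGroupBorelInduction                    -- ★ `cmLocalForm`, `cmDatum_Local_eq` (rfl)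
import Literature.NumberTheory.Automorphic.CentralCharacterCompactCenter                 -- ★ (this seat, G3 generic half): continuity ∕ unitarity of central characters
import Literature.NumberTheory.Rogawski1990.CMLocalAPacketMembers                        -- ★ `Rogawski1990.Gqs`, `qsForm`
import HarnessLib

/-!
# `F0P3bCentralCharacterUnitaryNonsplit` — at a NON-split place the central character of an irreducible admissible `π` of `U(Φ_N)(L⁺_v)` is UNITARY

Cell `hodgecm-mathlib`, F0∕P3 «U3-mult», crux H413 (`stmt-HodgeConjecture-24833`); T3a-TREE §3 glue **G3 `centralChar_unitary_nonsplit`**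
(typ-T3a (g0) ∕ typ-T3b (g0), desk F0P3b-plan (g8)), pen A-p01 (g17).  It discharges clause (a) «`ω` unitary» of Casselman's
square-integrability criterion [Casselman1995 Thm 4.4.6] — the conjunct `(∀ z, ‖((ω z : ℂˣ) : ℂ)‖ = 1)` of ★
`UnitaryGroup.U3SquareIntegrableExponents` (T3a N5) — for every irreducible admissible (indeed every smooth, `V ≠ 0`) representation
of `G = U(Φ_N)(L⁺_v)` at a finite place `v` of `L⁺` that does not split in `L`: the centre `Z(G) = E¹_v · 1_N` is COMPACT there
(★ p825600 `F0P3bLocalNonsplitCompactCenter.local_nonsplit_compactOpen_center_of_center_le` + ★ `UnitaryGroup.forall_mem_center_cmLocal_eq_scalar`),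
the central character of a smooth representation is continuous, and a continuous homomorphism from a compact group to `ℂˣ` is unitary
(★ `Representation.IsSmooth.norm_centralCharacter_eq_one_of_isCompact_center`, this seat's generic half
`Literature/NumberTheory/Automorphic/CentralCharacterCompactCenter.lean`).

WHAT IS PROVED (theorems only; no `sorry`, no `def`, no instance):
* `isCompact_center_cmLocal_of_nonsplit` — the centre of `↥(unitaryGroupOfForm (c ⊗ 1) (cmLocalForm L N v))` (= `(cmDatum L N Φ_N).Local v`, `rfl`)
  is compact at a non-split `v`; `exists_isOpen_isCompact_subgroup_cmLocal` — it has a compact open subgroup (any `v`).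
* `norm_centralChar_eq_one_of_nonsplit` — **N5's clause (a) token for token**: `π` smooth on `V ≠ 0`, `ω : Z(G) →* ℂˣ` with
  `∀ z x, π z x = ω z • x` ⟹ `∀ z, ‖((ω z : ℂˣ) : ℂ)‖ = 1`; `…_of_isAdmissible` for `π` irreducible admissible (N5's binders).
* `exists_centralChar_norm_eq_one_of_nonsplit` — Schur + the above: an irreducible admissible `π` HAS such an `ω`, unitary.
* `IrrClass.exists_hasCentralCharacter_norm_eq_one_Gqs` — class form on ★ `Rogawski1990.Gqs L v` (`c.IsAdmissible`), the currency of
  T3b's stub S3 `stub_isSquareIntegrable_iff_decays`.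

HONEST LABEL: HC_CM is proved only modulo the printed citations until rung 0 closes; this glue discharges nothing by itself.
[Rogawski1990 §12.2 p. 173; Casselman1995 Thm 4.4.6 (a); BernsteinZelevinsky1976 §2.10–2.11]
-/

set_option autoImplicit false
set_option linter.dupNamespace false

noncomputable section

open NumberField IsDedekindDomain
open Literature.NumberTheory.Automorphic Literature.NumberTheory.Automorphic.UnitaryGroup Literature.NumberTheory.Rogawski1990
open scoped Matrix MatrixGroups

namespace Summit.HodgeConjecture.HodgeConjecture.Cruxes.H413.F0P3bCentralCharacterUnitaryNonsplit

variable (L : Type) [Field L] [NumberField L] [IsCMField L] (N : ℕ) (v : HeightOneSpectrum (𝓞 ↥(maximalRealSubfield L)))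

/-! ## §1 The frame at a non-split place, on the carrier `↥(unitaryGroupOfForm (c ⊗ 1) (cmLocalForm L N v))` -/

/-- **The centre of `U(Φ_N)(L⁺_v)` is compact at a non-split `v`** (★ p825600 + ★ «central ⇒ scalar», instantiated at the split
form `Φ_N`, ★ `antidiagOne_isHermitian`, ★ `isUnit_antidiagOne_det`; carrier `(cmDatum L N Φ_N).Local v` IS the subtype by `rfl`).
[cite: Rogawski1990, §12.2 p. 173] [cite: PlatonovRapinchuk1994, §3.3; §5.1] -/
theorem isCompact_center_cmLocal_of_nonsplit (hns : ∀ w : PlacesOver L v, IsCMField.complexConj L • w.1 = w.1) :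
    IsCompact ((Subgroup.center ↥(unitaryGroupOfForm (conjLocal L (IsCMField.complexConj L) v) (cmLocalForm L N v)) :
      Subgroup ↥(unitaryGroupOfForm (conjLocal L (IsCMField.complexConj L) v) (cmLocalForm L N v))) :
        Set ↥(unitaryGroupOfForm (conjLocal L (IsCMField.complexConj L) v) (cmLocalForm L N v))) :=
  (F0P3bLocalNonsplitCompactCenter.local_nonsplit_compactOpen_center_of_center_le L N
      (Matrix.of fun i j : Fin N => if i.val + j.val + 1 = N then (1 : L) else 0) (isUnit_antidiagOne_det L N) v hns
    (forall_mem_center_cmLocal_eq_scalar L _ (antidiagOne_isHermitian L N) (isUnit_antidiagOne_det L N) v hns)).2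

/-- `U(Φ_N)(L⁺_v)` has a compact open subgroup (the level `U(Φ_N)(𝒪_v)`; any finite `v`). [cite: PlatonovRapinchuk1994, §5.1] -/
theorem exists_isOpen_isCompact_subgroup_cmLocal :
    ∃ K₀ : Subgroup ↥(unitaryGroupOfForm (conjLocal L (IsCMField.complexConj L) v) (cmLocalForm L N v)),
      IsOpen (K₀ : Set ↥(unitaryGroupOfForm (conjLocal L (IsCMField.complexConj L) v) (cmLocalForm L N v))) ∧
        IsCompact (K₀ : Set ↥(unitaryGroupOfForm (conjLocal L (IsCMField.complexConj L) v) (cmLocalForm L N v))) :=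
  F0P3bLocalNonsplitCompactCenter.exists_compactOpen_subgroup_local (IsCMField.complexConj L)
    (Matrix.of fun i j : Fin N => if i.val + j.val + 1 = N then (1 : L) else 0) v

/-! ## §2 Unitarity of the central character at a non-split place -/

/-- **G3, N5's clause (a) token for token**: at a non-split `v`, for a SMOOTH representation `π` of `U(Φ_N)(L⁺_v)` on `V ≠ 0` and
`ω : Z →* ℂˣ` with `π z x = ω z • x`, one has `‖ω z‖ = 1` for every central `z` (`Z = E¹_v · 1` compact; `ω` continuous by
smoothness; continuous characters of compact groups are unitary). [cite: Rogawski1990, §12.2 p. 173] [cite: Casselman1995, Thm 4.4.6 (a)] -/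
theorem norm_centralChar_eq_one_of_nonsplit (hns : ∀ w : PlacesOver L v, IsCMField.complexConj L • w.1 = w.1)
    {V : Type*} [AddCommGroup V] [Module ℂ V] [Nontrivial V]
    (π : Representation ℂ ↥(unitaryGroupOfForm (conjLocal L (IsCMField.complexConj L) v) (cmLocalForm L N v)) V)
    (hπ : π.IsSmooth)
    (ω : ↥(Subgroup.center ↥(unitaryGroupOfForm (conjLocal L (IsCMField.complexConj L) v) (cmLocalForm L N v))) →* ℂˣ)
    (hω : ∀ (z : ↥(Subgroup.center ↥(unitaryGroupOfForm (conjLocal L (IsCMField.complexConj L) v) (cmLocalForm L N v)))) (x : V),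
      π (z : ↥(unitaryGroupOfForm (conjLocal L (IsCMField.complexConj L) v) (cmLocalForm L N v))) x = ((ω z : ℂˣ) : ℂ) • x)
    (z : ↥(Subgroup.center ↥(unitaryGroupOfForm (conjLocal L (IsCMField.complexConj L) v) (cmLocalForm L N v)))) :
    ‖((ω z : ℂˣ) : ℂ)‖ = 1 :=
  hπ.norm_eq_one_of_forall_apply_eq_smul ω hω (isCompact_center_cmLocal_of_nonsplit L N v hns) z

/-- The same with N5's binders: `π` IRREDUCIBLE ADMISSIBLE (so `V ≠ 0` and `π` smooth). [cite: Rogawski1990, §12.2 p. 173]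
[cite: Casselman1995, Thm 4.4.6 (a)] -/
theorem norm_centralChar_eq_one_of_nonsplit_of_isAdmissible (hns : ∀ w : PlacesOver L v, IsCMField.complexConj L • w.1 = w.1)
    {V : Type*} [AddCommGroup V] [Module ℂ V]
    (π : Representation ℂ ↥(unitaryGroupOfForm (conjLocal L (IsCMField.complexConj L) v) (cmLocalForm L N v)) V)
    [π.IsIrreducible] (hπ : π.IsAdmissible)
    (ω : ↥(Subgroup.center ↥(unitaryGroupOfForm (conjLocal L (IsCMField.complexConj L) v) (cmLocalForm L N v))) →* ℂˣ)
    (hω : ∀ (z : ↥(Subgroup.center ↥(unitaryGroupOfForm (conjLocal L (IsCMField.complexConj L) v) (cmLocalForm L N v)))) (x : V),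
      π (z : ↥(unitaryGroupOfForm (conjLocal L (IsCMField.complexConj L) v) (cmLocalForm L N v))) x = ((ω z : ℂˣ) : ℂ) • x)
    (z : ↥(Subgroup.center ↥(unitaryGroupOfForm (conjLocal L (IsCMField.complexConj L) v) (cmLocalForm L N v)))) :
    ‖((ω z : ℂˣ) : ℂ)‖ = 1 := by
  haveI : Nontrivial V := Representation.IsIrreducible.nontrivial π
  exact norm_centralChar_eq_one_of_nonsplit L N v hns π hπ.isSmooth ω hω z

/-- **Existence + unitarity** (Schur, ★ `Representation.IsAdmissible.exists_hasCentralCharacter`, with the compact open level and the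
compact centre): an irreducible admissible `π` of `U(Φ_N)(L⁺_v)`, `v` non-split, has a central character `ω`, `π z x = ω z • x`, with
`‖ω z‖ = 1`. [cite: Rogawski1990, §12.2 p. 173] [cite: BushnellHenniart2006, §2.6 Corollary 1] -/
theorem exists_centralChar_norm_eq_one_of_nonsplit (hns : ∀ w : PlacesOver L v, IsCMField.complexConj L • w.1 = w.1)
    {V : Type*} [AddCommGroup V] [Module ℂ V]
    (π : Representation ℂ ↥(unitaryGroupOfForm (conjLocal L (IsCMField.complexConj L) v) (cmLocalForm L N v)) V)
    [π.IsIrreducible] (hπ : π.IsAdmissible) :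
    ∃ ω : ↥(Subgroup.center ↥(unitaryGroupOfForm (conjLocal L (IsCMField.complexConj L) v) (cmLocalForm L N v))) →* ℂˣ,
      (∀ (z : ↥(Subgroup.center ↥(unitaryGroupOfForm (conjLocal L (IsCMField.complexConj L) v) (cmLocalForm L N v)))) (x : V),
          π (z : ↥(unitaryGroupOfForm (conjLocal L (IsCMField.complexConj L) v) (cmLocalForm L N v))) x = ((ω z : ℂˣ) : ℂ) • x) ∧
        ∀ z, ‖((ω z : ℂˣ) : ℂ)‖ = 1 := by
  obtain ⟨K₀, hK₀o, hK₀c⟩ := exists_isOpen_isCompact_subgroup_cmLocal L N v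
  exact hπ.exists_forall_apply_eq_smul_norm_eq_one hK₀o hK₀c (isCompact_center_cmLocal_of_nonsplit L N v hns)

/-! ## §3 Class form on `Gqs L v = U(Φ₃)(L⁺_v)` (T3b's S3 currency) -/

/-- **Class form at `N = 3`** (★ `Rogawski1990.Gqs L v = (cmDatum L 3 Φ₃).Local v`, ★ `IrrClass.IsAdmissible`, ★ `IrrClass.HasCentralCharacter`):
at a non-split `v`, every irreducible admissible class of `U(Φ₃)(L⁺_v)` has a unitary central character — the «(a) `ω` unitary,
automatic» input of T3b's stub S3. [cite: Rogawski1990, §12.2 p. 173] [cite: Casselman1995, Thm 4.4.6 (a)] -/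
theorem IrrClass.exists_hasCentralCharacter_norm_eq_one_Gqs (hns : ∀ w : PlacesOver L v, IsCMField.complexConj L • w.1 = w.1)
    (c : IrrClass (Gqs L v)) (hc : c.IsAdmissible) :
    ∃ ω : ↥(Subgroup.center (Gqs L v)) →* ℂˣ, c.HasCentralCharacter ω ∧ ∀ z, ‖((ω z : ℂˣ) : ℂ)‖ = 1 := by
  obtain ⟨K₀, hK₀o, hK₀c⟩ := exists_isOpen_isCompact_subgroup_cmLocal L 3 v
  exact c.exists_hasCentralCharacter_norm_eq_one hc hK₀o hK₀c (isCompact_center_cmLocal_of_nonsplit L 3 v hns)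

end Summit.HodgeConjecture.HodgeConjecture.Cruxes.H413.F0P3bCentralCharacterUnitaryNonsplit

end
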